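import Summits.Ventures.PercRepro.S1CapTenSix

/-!
# PercRepro — THE TWO-LINE FIBRE BOUNDS (p2, gen 25; SUBCLAIM-S1 §6.9 (xii) T3, part 1)

The two fibre bounds of S1ConeCandidates for a point `x` on exactly two triangles `L₁, L₂`: the candidates
(`4`-sets `K ∋ x` of rank `3` containing neither line) with a point on each line number at most `4`, and those
through two given outside points at most `2`. The count `≤ 34` is assembled in S1ConeTwo.

* **`ncard_candidates_two_lines_le_four'`**, **`ncard_candidates_pair_le_two'`**.
Axioms: standard.
-/

open scoped Matroid

namespace PercRepro

namespace S1

open Set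

variable {α : Type}

/-- **The candidates with a point on each of the two lines through `x` number at most `4`** (the two-line form of
S1ConeCandidates' lemma): the outside point is determined by the two cone points (S1ConeGeometry (b)). -/
theorem ncard_candidates_two_lines_le_four' (N : Matroid α) [N.Finite]
    (hC1 : ∀ L ⊆ N.E, N.eRk L = 2 → L.ncard ≤ 3) (hC2 : ∀ P ⊆ N.E, N.eRk P ≤ 3 → P.ncard ≤ 6)
    {x : α} {L L' : Set α} (hL : L ∈ ThmN.trianglesThrough N x) (hL' : L' ∈ ThmN.trianglesThrough N x)
    (hne : L ≠ L') (𝒦 : Set (Set α))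
    (h𝒦 : ∀ K ∈ 𝒦, K ⊆ N.E ∧ x ∈ K ∧ K.ncard = 4 ∧ N.eRk K = 3 ∧ ¬ L ⊆ K ∧ ¬ L' ⊆ K) :
    {K ∈ 𝒦 | ∃ a ∈ K, a ∈ L ∧ a ≠ x ∧ ∃ b ∈ K, b ∈ L' ∧ b ≠ x}.ncard ≤ 4 := by
  have hLE := hL.1.subset_ground
  have hL'E := hL'.1.subset_ground
  have hxE : x ∈ N.E := hLE hL.2.2
  -- the structure of a member: `K = {x, a, b, w}` with `w` outside the two lines
  have hstruct : ∀ K ∈ 𝒦, ∀ a ∈ K, a ∈ L → a ≠ x → ∀ b ∈ K, b ∈ L' → b ≠ x →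
      ∃ w, w ∈ N.E ∧ w ∉ L ∪ L' ∧ w ≠ x ∧ K = {x, a, b, w} := by
    intro K hK a haK haL hax b hbK hbL' hbx
    obtain ⟨hKE, hxK, hK4, hKr, hLK, hL'K⟩ := h𝒦 K hK
    have hab : a ≠ b := by
      rintro rfl
      have hint := ThmN.inter_eq_singleton_of_mem_trianglesThrough N hC1 hL hL' hne
      have : a ∈ L ∩ L' := ⟨haL, hbL'⟩
      rw [hint] at this
      exact hax this
    obtain ⟨w, hwK, hwx, hwa, hwb, hKeq⟩ := exists_fourth_of_ncard_four hK4 hxK haK hbK (Ne.symm hax) (Ne.symm hbx) hab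
    refine ⟨w, hKE hwK, ?_, hwx, hKeq⟩
    rintro (hwL | hwL')
    · exact not_two_of_line hL hxK hLK haK hwK (Ne.symm hwa) hax hwx haL hwL
    · exact not_two_of_line hL' hxK hL'K hbK hwK (Ne.symm hwb) hbx hwx hbL' hwL'
  -- the injection `K ↦ (K ∩ (L ∖ x), K ∩ (L' ∖ x))`
  have hfin : (L \ {x}).Finite := N.ground_finite.subset (sdiff_subset.trans hLE)
  have hfin' : (L' \ {x}).Finite := N.ground_finite.subset (sdiff_subset.trans hL'E)
  have htarget : ((fun p : α × α => (({p.1} : Set α), ({p.2} : Set α))) '' ((L \ {x}) ×ˢ (L' \ {x}))).ncard ≤ 4 := by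
    refine (Set.ncard_image_le (hfin.prod hfin')).trans ?_
    rw [Set.ncard_prod, Set.ncard_sdiff_singleton_of_mem hL.2.2, Set.ncard_sdiff_singleton_of_mem hL'.2.2,
      hL.2.1, hL'.2.1]
  refine (Set.ncard_le_ncard_of_injOn (fun K => (K ∩ (L \ {x}), K ∩ (L' \ {x}))) ?_ ?_
    ((hfin.prod hfin').image _)).trans htarget
  · rintro K ⟨hK, a, haK, haL, hax, b, hbK, hbL', hbx⟩
    obtain ⟨hKE, hxK, hK4, hKr, hLK, hL'K⟩ := h𝒦 K hK
    refine ⟨(a, b), ⟨⟨haL, hax⟩, ⟨hbL', hbx⟩⟩, ?_⟩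
    simp only [Prod.mk.injEq]
    constructor
    · ext y
      constructor
      · intro hy
        rw [Set.mem_singleton_iff] at hy
        rw [hy]
        exact ⟨haK, haL, fun h => hax (Set.mem_singleton_iff.1 h)⟩
      · intro hy
        have hyx : y ≠ x := fun h => hy.2.2 (Set.mem_singleton_iff.2 h)
        rw [Set.mem_singleton_iff]
        by_contra hya
        exact not_two_of_line hL hxK hLK hy.1 haK hya hyx hax hy.2.1 haL
    · ext y
      constructor
      · intro hy
        rw [Set.mem_singleton_iff] at hy
        rw [hy]
        exact ⟨hbK, hbL', fun h => hbx (Set.mem_singleton_iff.1 h)⟩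
      · intro hy
        have hyx : y ≠ x := fun h => hy.2.2 (Set.mem_singleton_iff.2 h)
        rw [Set.mem_singleton_iff]
        by_contra hyb
        exact not_two_of_line hL' hxK hL'K hy.1 hbK hyb hyx hbx hy.2.1 hbL'
  · rintro K ⟨hK, a, haK, haL, hax, b, hbK, hbL', hbx⟩ K' ⟨hK', a', ha'K, ha'L, ha'x, b', hb'K, hb'L', hb'x⟩ heq
    simp only [Prod.mk.injEq] at heq
    obtain ⟨heqa, heqb⟩ := heq
    -- `a = a'`, `b = b'`
    have haa' : a = a' := by
      have h1 : a ∈ K ∩ (L \ {x}) := ⟨haK, haL, hax⟩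
      rw [heqa] at h1
      have h2 : a' ∈ K' ∩ (L \ {x}) := ⟨ha'K, ha'L, ha'x⟩
      obtain ⟨-, hxK', -, -, hLK', -⟩ := h𝒦 K' hK'
      by_contra hne₀
      exact not_two_of_line hL hxK' hLK' h1.1 ha'K hne₀ hax ha'x haL ha'L
    have hbb' : b = b' := by
      have h1 : b ∈ K ∩ (L' \ {x}) := ⟨hbK, hbL', hbx⟩
      rw [heqb] at h1
      obtain ⟨-, hxK', -, -, -, hL'K'⟩ := h𝒦 K' hK'
      by_contra hne₀
      exact not_two_of_line hL' hxK' hL'K' h1.1 hb'K hne₀ hbx hb'x hbL' hb'L'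
    subst haa' hbb'
    obtain ⟨w, hwE, hwLL', hwx, hKeq⟩ := hstruct K hK a haK haL hax b hbK hbL' hbx
    obtain ⟨w', hw'E, hw'LL', hw'x, hK'eq⟩ := hstruct K' hK' a ha'K ha'L ha'x b hb'K hb'L' hb'x
    obtain ⟨-, -, -, hKr, -, -⟩ := h𝒦 K hK
    obtain ⟨-, -, -, hK'r, -, -⟩ := h𝒦 K' hK'
    rw [hKeq] at hKr
    rw [hK'eq] at hK'r
    have := eq_of_eRk_three_two_lines N hC1 hC2 hL hL' hne haL hax haL hax hbL' hbx hbL' hbx hwE hw'E hwLL'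
      hw'LL' hKr hK'r
    rw [hKeq, hK'eq, this]

/-- **The candidates through two given outside points number at most `2`** (two-line form): their cone point lies
on one of the two lines (S1ConeGeometry (c)), which has two points besides `x`. -/
theorem ncard_candidates_pair_le_two' (N : Matroid α) [N.Finite]
    (hC1 : ∀ L ⊆ N.E, N.eRk L = 2 → L.ncard ≤ 3) (hC2 : ∀ P ⊆ N.E, N.eRk P ≤ 3 → P.ncard ≤ 6)
    (hcirc : ∀ C, N.IsCircuit C → 3 ≤ C.ncard)
    {x : α} {L₁ L₂ : Set α} (hL₁ : L₁ ∈ ThmN.trianglesThrough N x) (hL₂ : L₂ ∈ ThmN.trianglesThrough N x)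
    (𝒦 : Set (Set α)) (h𝒦 : ∀ K ∈ 𝒦, K ⊆ N.E ∧ x ∈ K ∧ K.ncard = 4 ∧ N.eRk K = 3)
    {s t : α} (hs : s ∈ N.E) (ht : t ∈ N.E) (hst : s ≠ t) (hsL : s ∉ L₁ ∪ L₂) (htL : t ∉ L₁ ∪ L₂)
    (hnotri : ∀ C ∈ ThmN.trianglesThrough N x, s ∉ C) :
    {K ∈ 𝒦 | s ∈ K ∧ t ∈ K ∧ ∃ a ∈ K, a ∈ L₁ ∪ L₂ ∧ a ≠ x}.ncard ≤ 2 := by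
  set G := {K ∈ 𝒦 | s ∈ K ∧ t ∈ K ∧ ∃ a ∈ K, a ∈ L₁ ∪ L₂ ∧ a ≠ x} with hG
  have hxE : x ∈ N.E := hL₁.1.subset_ground hL₁.2.2
  have hxs : x ≠ s := fun h => hsL (Or.inl (h ▸ hL₁.2.2))
  have hxt : x ≠ t := fun h => htL (Or.inl (h ▸ hL₁.2.2))
  have hsnot : ∀ L, (L = L₁ ∨ L = L₂) → s ∉ L := by
    rintro L (rfl | rfl) hsL'
    · exact hsL (Or.inl hsL')
    · exact hsL (Or.inr hsL')
  have htnot : ∀ L, (L = L₁ ∨ L = L₂) → t ∉ L := by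
    rintro L (rfl | rfl) htL'
    · exact htL (Or.inl htL')
    · exact htL (Or.inr htL')
  have hmemtri : ∀ L, (L = L₁ ∨ L = L₂) → L ∈ ThmN.trianglesThrough N x := by
    rintro L (rfl | rfl) <;> assumption
  -- every member is `{x, a, s, t}` with its cone point `a`
  have hstruct : ∀ K ∈ G, ∀ a ∈ K, a ∈ L₁ ∪ L₂ → a ≠ x → K = {x, a, s, t} := by
    rintro K ⟨hK, hsK, htK, -⟩ a haK hacone hax
    obtain ⟨-, hxK, hK4, -⟩ := h𝒦 K hK
    obtain ⟨w, hwK, hwx, hws, hwt, hKeq⟩ := exists_fourth_of_ncard_four hK4 hxK hsK htK hxs hxt hst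
    have has : a ≠ s := fun h => hsL (h ▸ hacone)
    have hat : a ≠ t := fun h => htL (h ▸ hacone)
    have haw : a = w := by
      have : a ∈ ({x, s, t, w} : Set α) := hKeq ▸ haK
      simp only [Set.mem_insert_iff, Set.mem_singleton_iff] at this
      rcases this with h | h | h | h
      · exact absurd h hax
      · exact absurd h has
      · exact absurd h hat
      · exact h
    rw [hKeq, haw]
    ext z; simp; tauto
  by_cases hGe : G = ∅
  · rw [hGe, Set.ncard_empty]; omega
  obtain ⟨K₀, hK₀⟩ := Set.nonempty_iff_ne_empty.2 hGe
  obtain ⟨hK₀𝒦, hsK₀, htK₀, a₀, ha₀K, ha₀cone, ha₀x⟩ := hK₀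
  obtain ⟨L₀, hL₀mem, ha₀L₀⟩ : ∃ L₀, (L₀ = L₁ ∨ L₀ = L₂) ∧ a₀ ∈ L₀ := by
    rcases ha₀cone with h | h
    · exact ⟨L₁, Or.inl rfl, h⟩
    · exact ⟨L₂, Or.inr rfl, h⟩
  have hL₀ := hmemtri L₀ hL₀mem
  have hK₀eq := hstruct K₀ ⟨hK₀𝒦, hsK₀, htK₀, a₀, ha₀K, ha₀cone, ha₀x⟩ a₀ ha₀K ha₀cone ha₀x
  have hK₀r : N.eRk {x, a₀, s, t} = 3 := by rw [← hK₀eq]; exact (h𝒦 K₀ hK₀𝒦).2.2.2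
  -- every cone point of a member lies on `L₀`
  have hsub : G ⊆ (fun a => ({x, a, s, t} : Set α)) '' (L₀ \ {x}) := by
    rintro K ⟨hK, hsK, htK, a, haK, hacone, hax⟩
    have hKeq := hstruct K ⟨hK, hsK, htK, a, haK, hacone, hax⟩ a haK hacone hax
    have hKr : N.eRk {x, a, s, t} = 3 := by rw [← hKeq]; exact (h𝒦 K hK).2.2.2
    obtain ⟨L, hLmem, haL⟩ : ∃ L, (L = L₁ ∨ L = L₂) ∧ a ∈ L := by
      rcases hacone with h | h
      · exact ⟨L₁, Or.inl rfl, h⟩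
      · exact ⟨L₂, Or.inr rfl, h⟩
    have haL₀ : a ∈ L₀ := by
      by_cases hLL₀ : L = L₀
      · rw [← hLL₀]; exact haL
      · exfalso
        exact not_eRk_three_pair_two_lines N hC1 hC2 hcirc hL₀ (hmemtri L hLmem) (Ne.symm hLL₀) ha₀L₀ ha₀x haL hax
          hs ht hst (fun h => h.elim (hsnot L₀ hL₀mem) (hsnot L hLmem))
          (fun h => h.elim (htnot L₀ hL₀mem) (htnot L hLmem)) hnotri hK₀r hKr
    exact ⟨a, ⟨haL₀, fun h => hax (Set.mem_singleton_iff.1 h)⟩, hKeq.symm⟩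
  have hfin : (L₀ \ {x}).Finite := N.ground_finite.subset (sdiff_subset.trans hL₀.1.subset_ground)
  calc G.ncard ≤ ((fun a => ({x, a, s, t} : Set α)) '' (L₀ \ {x})).ncard := Set.ncard_le_ncard hsub (hfin.image _)
    _ ≤ (L₀ \ {x}).ncard := Set.ncard_image_le hfin
    _ = 2 := by rw [Set.ncard_sdiff_singleton_of_mem hL₀.2.2, hL₀.2.1]

end S1

end PercRepro
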